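/-
Copyright (c) 2026 the pub-hodgecm-mathlib formalisation cell (harness21).  Prover seat hodgecm-mathlib-LH4-p09 (g5): Track A «(D-RAM) FOUR-FRAME» squad of crux H413, unit U2H (ii-H),
leaf (ρ2b′-X) — payer LH4-p14 (g4) socket (C) brick **(C2) «H-SIDE CLOSED FORM»**, the HEAD: ★ (C2-i) ∘ ★ (C2-ii) ∘ ★ (C2-iii) at the ramified CM place, 2026-09-04.
-/
import Summits.HodgeConjecture.HodgeConjecture.Theorems.F0P3cDyRamHSideFixedCountTorusForm   -- ★ p857582 (C2-i, this seat): `(q − 1)·(#Fix + d % 2) + 2 = (q + 1)·qⁿ ∕ 2·q^{n+1}` in torus-form tokens (K₂ column, parity selector)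
import Summits.HodgeConjecture.HodgeConjecture.Theorems.F0P3cDyRamHSideLevelLetter            -- ★ (C2-iii, this seat): `valued_pow_mul_trace_sq_eq_of_descent` (level UP), `valuation_disc_lt_of_descent` (tube DOWN); brings ★ `not_isSquare_disc_of_descent_of_not_exists_isRoot`
import Literature.NumberTheory.Automorphic.SLTwoTreeDeepEllipticTorusDatum                      -- ★ p857631 (C2-ii, this seat): `exists_torusDatum_of_deep`; brings ★ `henselianLocalRing_integer_adicCompletion`, the Valued∕ValuativeRel bridge
import HarnessLib

/-!
# F0 · P3c · line LH4 «(D-RAM) FOUR-FRAME» — unit (ii-H), leaf (ρ2b′-X), socket (C) brick (C2), HEAD: THE H-SIDE CLOSED FORM OF A TYPE-(2) ELEMENT IN THE TUBE —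
# `(q_w − 1)·(#Fix_{γ₂}(U₂(L⁺_v) ⧸ K₂) + d % 2) + 2 = (q_w + 1)·q_wⁿ` (unramified eigen-field of the descent, `d_K = 0`) OR `= 2·q_w^{n+1}` (ramified, `d_K ≥ 1`), WITH
# `|ϖ_w|^{2(2n + d_K)}·|tr γ₂|_w² = |4·(tr²γ₂ − 4 det γ₂)|_w` (Kottwitz 1988 §2; Labesse–Langlands 1979 §2; Rogawski 1990 §4.9)

Cell `pub/hodgecm-mathlib` (D-0151), crux H413 = `stmt-HodgeConjecture-24833` (helper lane `--supports stmt-HodgeConjecture-24833 --as helper`, count-neutral); THEOREMS ONLY (no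
definition, no instance, no notation, no named fact, no `sorry`, default heartbeats).  Tree socket served: (ρ2b′-X) `stub_U2H_fixedPointCensus_typeTwo_unit0` (U2H ED. 15 :418)
through the payer lineage's organ interface ★ p857374 `hOrgNV` (H-side clause `#Fix_{γ₂}(U₂ ⧸ K₂) + d % 2 = N_V`) — socket (C) of ★ p857565 `hOrgNV_at_of_organs`, brick (C2)
«H-SIDE CLOSED FORM» dealt to this seat (payer LH4-p14 (g4) 2026-09-04T05:05:59Z; dealer WORD #27; MAP v1∕v2 seam S8).

WHAT IS PROVED — ONE CALL for the census file.  At a ramified non-split place `w ∣ v` of the CM field `L` (`he`) with the quadratic datum of record `(σ_w, ϖ, d, t_E)`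
(`IsRamifiedQuadraticDatum`), a uniformiser `ϖ_v` of `L⁺_v`, an anti-fixed `α` (`σ_w α = −α`, `|α| = 1 ∨ |α| = |ϖ_w|` — ★ anti-fixed dichotomy), let `γ₂ ∈ U₂ = U(Φ₂)(L⁺_v)` be of TYPE
(2) (the characteristic polynomial of `E₂γ₂` has no root in `L_w`, the :418 letter `hirr`) with a descent representative `diag(1, α)·E₂γ₂·diag(1, α)⁻¹ = s·ι_w(g)` (★
`exists_conj_diagonal_eq_smul_map_toPlace`) and IN THE TUBE `|tr²(E₂γ₂) − 4 det(E₂γ₂)|_w < |4|_w·|ϖ|_w²·|tr(E₂γ₂)|_w²`.  THEN (`hSide_closedForm_of_tube`) there are the torus datum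
`(u, w, z)` of `g` (`(u² + 4w)·z² = tr²g − 4 det g`, `z ≠ 0`, `u ∈ 𝒪_v`) and `n d_K : ℕ` such that EITHER the eigen-field `L⁺_v(√(tr²g − 4det g))` is UNRAMIFIED — `(u, w)` INERT,
`d_K = 0` and **`(q_w − 1)·(#Fix_{γ₂}(U₂ ⧸ K₂) + d % 2) + 2 = (q_w + 1)·q_wⁿ`** — OR it is RAMIFIED — `(u, w)` EISENSTEIN and **`(q_w − 1)·(#Fix_{γ₂}(U₂ ⧸ K₂) + d % 2) + 2 =
2·q_w^{n+1}`** —, with `|u² + 4w|_v = |ϖ_v|^{d_K}` and THE LEVEL IDENTITY UPSTAIRS **`|ϖ|_w^{2(2n + d_K)}·|tr E₂γ₂|_w² = |4·(tr² E₂γ₂ − 4 det E₂γ₂)|_w`** (`q_w = #𝓀_w`,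
`#Fix = Nat.card (fixedBy (U₂ ⧸ cmLocalIntegralLevel L 2 Φ₂ v) γ₂)`, the letters of ★ p857374).  With ★ (C2-iii) §3 (`eq_conductorLevel_of_level_of_tube`) the census file turns the
level identity into `2n + d_K = jl` for the conductor level `jl` of the eigenvalue in the line model (classes U: `2n = jl`; RK: `2n + d = jl`; heir LEAD T19-05 (1)), so its `N_V := #Fix +
d % 2` satisfies `(q − 1)·N_V + 2 = (q + 1)·q^{jl∕2}` (U) ∕ `2·q^{(jl − d_K)∕2 + 1}` (RK∕RM) — the S7∕S8 meeting point (★ p857467∕p857558 `2·n_H = jl`).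
THE PROOF is a composition of ★ bricks: `tr²g − 4det g` is a non-square (★ `not_isSquare_disc_of_descent_of_not_exists_isRoot`, `2 ≠ 0`); the tube descends to (C2-ii)'s deepness
(★ `valuation_disc_lt_of_descent`); ★ p857631 `exists_torusDatum_of_deep` (★ `𝒪[L⁺_v]` Henselian and discrete) yields the datum, the conjugation `h g h⁻¹ = c·(1, bw; b, 1 + bu)`, the
depth `|b| = |ϖ_v|ⁿ`, the class disjunction and the F-level identity; ★ p857582 `pred_card_valuedResidueField_mul_natCard_fixedBy_add_mod_two_add_two_of_{inert,eisenstein}` gives the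
two laws; ★ `valued_pow_mul_trace_sq_eq_of_descent` carries the level identity up.
* `hSide_closedForm_of_tube` — the head as above (descent binders `α, s, g` supplied by the caller, as for ★ p857582); `hSide_closedForm_of_tube_exists` — the SELF-CONTAINED
  variant producing `α` (★ anti-fixed dichotomy) and `(s, g)` (★ descent) inside and returning them with their letters, so the caller needs only `γ₂`, `hirr`, the tube.

WHAT IS NOT CLAIMED.  Which branch occurs is decided by the eigen-field of `g` (= the third field `Fix(Θρ)` of the line model); matching it with the G-side's class (T5a∕T5b∕T5c frames) is
the census file's bookkeeping — the datum `(u, w, z)` is exported for that purpose (an Eisenstein datum exhibits the uniformiser `−w = N(τ)` as a NORM from `L⁺_v[g]`, an inert one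
makes all norms of `L⁺_v[g]` even).  Nothing printed is asserted; (ρ2b′-X) stays OPEN.  HONEST LABEL: HC_CM is proved only modulo the 7 printed citations (2 remaining named inputs:
hLiu418 = stmt-HodgeConjecture-24832, h413 = stmt-HodgeConjecture-24833) until rung 0 closes; count-neutral.

## References
* [Kottwitz1988] R. E. Kottwitz, *Tamagawa numbers*, Ann. of Math. 127 (1988), §2 (orbital integrals of indicators as fixed-coset counts; the fixed subtree of an elliptic element).
* [LabesseLanglands1979] J.-P. Labesse, R. P. Langlands, *L-indistinguishability for SL(2)*, Canad. J. Math. 31 (1979), §2 pp. 7–8 (quadratic tori, conductor, fixed balls).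
* [Rogawski1990] J. D. Rogawski, *Automorphic Representations of Unitary Groups in Three Variables*, Ann. of Math. Stud. 123 (1990), §4.9 Prop. 4.9.1 (b) p. 55, Lemma 4.9.3 p. 56.
* [Tits1979] J. Tits, *Reductive groups over local fields*, PSPM 33.1 (1979), §3.2 p. 50 (vertex and edge stabilisers of quasi-split `U(1,1)`).
* [Serre1979] J.-P. Serre, *Local Fields*, GTM 67 (1979), Ch. I §6, Ch. III §5, Ch. XIV §4.
-/

set_option autoImplicit false

noncomputable section

namespace Summit.HodgeConjecture.HodgeConjecture.Cruxes.H413.F0P3cDyRamHSideClosedForm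

open NumberField IsDedekindDomain MulAction Matrix WithZero ValuativeRel
open Literature.NumberTheory.Automorphic Literature.NumberTheory.Automorphic.UnitaryGroup
open Literature.NumberTheory.Automorphic.UnitaryThreeFourFrame
open Literature.NumberTheory.Automorphic.HermitianLatticeTree
open Summit.HodgeConjecture.HodgeConjecture.Cruxes.H413.F0P3cDyRamHSideFixedCountTorusForm
open Summit.HodgeConjecture.HodgeConjecture.Cruxes.H413.F0P3cDyRamHSideLevelLetter
open scoped Matrix MatrixGroups ValuativeRel WithZero

section Place

variable (L : Type) [Field L] [NumberField L] [IsCMField L] (v : HeightOneSpectrum (𝓞 ↥(maximalRealSubfield L)))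
  (w : PlacesOver L v) (hw : IsCMField.complexConj L • w.1 = w.1)
  {α : w.1.adicCompletion L} (hα : galAdicCompletionMap (L := L) (IsCMField.complexConj L) hw α = -α) (hα0 : α ≠ 0)
  {ϖF : v.adicCompletion ↥(maximalRealSubfield L)} (hϖF : Valued.v ϖF = exp (-1 : ℤ))
  [Finite (IsLocalRing.ResidueField 𝒪[v.adicCompletion ↥(maximalRealSubfield L)])] [Fintype (Valued.ResidueField (w.1.adicCompletion L))]

include hw hα hα0 hϖF in
/-- **(C2) THE H-SIDE CLOSED FORM OF (ρ2b′-X) FOR A TYPE-(2) ELEMENT IN THE TUBE — letters `q_w = #𝓀_w`.**  See the module docstring.  Inputs: the datum of record `hD`, an anti-fixed `α`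
(`hvα : |α| = 1 ∨ |α| = exp(−1)`), `γ₂ ∈ U₂` with NO `w`-root (`hirr`, the :418 letter), a descent representative `(s, g)` (`hs`, `hsg`), and the TUBE `htube :
|tr² − 4det|_w(E₂γ₂) < |4|_w·|ϖ|_w²·|tr E₂γ₂|_w²`.  Output: the torus datum `(u, w, z)` of `g`, `n d_K`, the class disjunction WITH ITS ℕ-LAW, `|u² + 4w| = |ϖ_v|^{d_K}`, and the level identity
upstairs.  ★ p857582 ∘ ★ p857631 ∘ ★ (C2-iii) ∘ ★ `not_isSquare_disc_of_descent_of_not_exists_isRoot`.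
[cite: Kottwitz1988, §2] [cite: LabesseLanglands1979, §2 pp. 7–8] [cite: Rogawski1990, §4.9 Prop. 4.9.1 (b) p. 55, Lemma 4.9.3 p. 56] [cite: Tits1979, §3.2 p. 50] [cite: Serre1979, Ch. I §6; Ch. III §5; Ch. XIV §4] -/
theorem hSide_closedForm_of_tube (he : v.asIdeal.ramificationIdx' w.1.asIdeal ≠ 1)
    {ϖ : w.1.adicCompletion L} {d tE : ℕ} (hD : IsRamifiedQuadraticDatum (galAdicCompletionMap (L := L) (IsCMField.complexConj L) hw) ϖ d tE)
    (hvα : Valued.v α = 1 ∨ Valued.v α = exp (-1 : ℤ))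
    (γ₂ : ((cmDatum L 2 (Matrix.of fun i j : Fin 2 => if i.val + j.val + 1 = 2 then (1 : L) else 0)).Local v))
    (hirr : ¬ ∃ x : (w.1.adicCompletion L),
      ((((localNonsplitEquiv (IsCMField.complexConj L) (Matrix.of fun i j : Fin 2 => if i.val + j.val + 1 = 2 then (1 : L) else 0) (IsCMField.complexConj_ne_one L) w hw) γ₂ : ↥(unitaryGroupOfForm (galAdicCompletionMap (L := L) (IsCMField.complexConj L) hw) (placeForm (Matrix.of fun i j : Fin 2 => if i.val + j.val + 1 = 2 then (1 : L) else 0) w.1))) : GL (Fin 2) (w.1.adicCompletion L)) : Matrix (Fin 2) (Fin 2) (w.1.adicCompletion L)).charpoly.IsRoot x)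
    -- the descent representative `g ∈ GL₂(L⁺_v)` of `E₂ γ₂` (★ `exists_conj_diagonal_eq_smul_map_toPlace`)
    {s : w.1.adicCompletion L} {g : GL (Fin 2) (v.adicCompletion ↥(maximalRealSubfield L))} (hs : s ≠ 0)
    (hsg : Matrix.diagonal ![1, α] * ((((localNonsplitEquiv (IsCMField.complexConj L) (Matrix.of fun i j : Fin 2 => if i.val + j.val + 1 = 2 then (1 : L) else 0) (IsCMField.complexConj_ne_one L) w hw) γ₂ : ↥(unitaryGroupOfForm (galAdicCompletionMap (L := L) (IsCMField.complexConj L) hw) (placeForm (Matrix.of fun i j : Fin 2 => if i.val + j.val + 1 = 2 then (1 : L) else 0) w.1))) : GL (Fin 2) (w.1.adicCompletion L)) : Matrix (Fin 2) (Fin 2) (w.1.adicCompletion L)) * Matrix.diagonal ![1, α⁻¹] =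
      s • (g : Matrix (Fin 2) (Fin 2) (v.adicCompletion ↥(maximalRealSubfield L))).map (toPlace v w))
    -- the tube
    (htube : Valued.v (((((localNonsplitEquiv (IsCMField.complexConj L) (Matrix.of fun i j : Fin 2 => if i.val + j.val + 1 = 2 then (1 : L) else 0) (IsCMField.complexConj_ne_one L) w hw) γ₂ : ↥(unitaryGroupOfForm (galAdicCompletionMap (L := L) (IsCMField.complexConj L) hw) (placeForm (Matrix.of fun i j : Fin 2 => if i.val + j.val + 1 = 2 then (1 : L) else 0) w.1))) : GL (Fin 2) (w.1.adicCompletion L)) : Matrix (Fin 2) (Fin 2) (w.1.adicCompletion L)).trace ^ 2 -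
        4 * ((((localNonsplitEquiv (IsCMField.complexConj L) (Matrix.of fun i j : Fin 2 => if i.val + j.val + 1 = 2 then (1 : L) else 0) (IsCMField.complexConj_ne_one L) w hw) γ₂ : ↥(unitaryGroupOfForm (galAdicCompletionMap (L := L) (IsCMField.complexConj L) hw) (placeForm (Matrix.of fun i j : Fin 2 => if i.val + j.val + 1 = 2 then (1 : L) else 0) w.1))) : GL (Fin 2) (w.1.adicCompletion L)) : Matrix (Fin 2) (Fin 2) (w.1.adicCompletion L)).det) <
      Valued.v (4 : w.1.adicCompletion L) * Valued.v ϖ ^ 2 *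
        Valued.v ((((localNonsplitEquiv (IsCMField.complexConj L) (Matrix.of fun i j : Fin 2 => if i.val + j.val + 1 = 2 then (1 : L) else 0) (IsCMField.complexConj_ne_one L) w hw) γ₂ : ↥(unitaryGroupOfForm (galAdicCompletionMap (L := L) (IsCMField.complexConj L) hw) (placeForm (Matrix.of fun i j : Fin 2 => if i.val + j.val + 1 = 2 then (1 : L) else 0) w.1))) : GL (Fin 2) (w.1.adicCompletion L)) : Matrix (Fin 2) (Fin 2) (w.1.adicCompletion L)).trace ^ 2) :
    ∃ (uτ wτ z : v.adicCompletion ↥(maximalRealSubfield L)) (n dK : ℕ),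
      z ≠ 0 ∧ (uτ ^ 2 + 4 * wτ) * z ^ 2 = (g : Matrix (Fin 2) (Fin 2) (v.adicCompletion ↥(maximalRealSubfield L))).trace ^ 2 - 4 * (g : Matrix (Fin 2) (Fin 2) (v.adicCompletion ↥(maximalRealSubfield L))).det ∧
      uτ ∈ 𝒪[v.adicCompletion ↥(maximalRealSubfield L)] ∧
      ((wτ ∈ 𝒪[v.adicCompletion ↥(maximalRealSubfield L)] ∧
          (∀ c e : v.adicCompletion ↥(maximalRealSubfield L), c ∈ 𝒪[v.adicCompletion ↥(maximalRealSubfield L)] → e ∈ 𝒪[v.adicCompletion ↥(maximalRealSubfield L)] →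
            valuation (v.adicCompletion ↥(maximalRealSubfield L)) (c ^ 2 + c * e * uτ - e ^ 2 * wτ) < 1 →
              valuation (v.adicCompletion ↥(maximalRealSubfield L)) c < 1 ∧ valuation (v.adicCompletion ↥(maximalRealSubfield L)) e < 1) ∧ dK = 0 ∧
          (Fintype.card (Valued.ResidueField (w.1.adicCompletion L)) - 1) *
              (Nat.card (fixedBy (((cmDatum L 2 (Matrix.of fun i j : Fin 2 => if i.val + j.val + 1 = 2 then (1 : L) else 0)).Local v) ⧸
                cmLocalIntegralLevel L 2 (Matrix.of fun i j : Fin 2 => if i.val + j.val + 1 = 2 then (1 : L) else 0) v) γ₂) + d % 2) + 2 =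
            (Fintype.card (Valued.ResidueField (w.1.adicCompletion L)) + 1) * Fintype.card (Valued.ResidueField (w.1.adicCompletion L)) ^ n) ∨
        (valuation (v.adicCompletion ↥(maximalRealSubfield L)) uτ < 1 ∧ valuation (v.adicCompletion ↥(maximalRealSubfield L)) wτ = valuation (v.adicCompletion ↥(maximalRealSubfield L)) ϖF ∧
          (Fintype.card (Valued.ResidueField (w.1.adicCompletion L)) - 1) *
              (Nat.card (fixedBy (((cmDatum L 2 (Matrix.of fun i j : Fin 2 => if i.val + j.val + 1 = 2 then (1 : L) else 0)).Local v) ⧸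
                cmLocalIntegralLevel L 2 (Matrix.of fun i j : Fin 2 => if i.val + j.val + 1 = 2 then (1 : L) else 0) v) γ₂) + d % 2) + 2 =
            2 * Fintype.card (Valued.ResidueField (w.1.adicCompletion L)) ^ (n + 1))) ∧
      valuation (v.adicCompletion ↥(maximalRealSubfield L)) (uτ ^ 2 + 4 * wτ) = valuation (v.adicCompletion ↥(maximalRealSubfield L)) ϖF ^ dK ∧
      Valued.v ϖ ^ (2 * (2 * n + dK)) *
          Valued.v ((((localNonsplitEquiv (IsCMField.complexConj L) (Matrix.of fun i j : Fin 2 => if i.val + j.val + 1 = 2 then (1 : L) else 0) (IsCMField.complexConj_ne_one L) w hw) γ₂ : ↥(unitaryGroupOfForm (galAdicCompletionMap (L := L) (IsCMField.complexConj L) hw) (placeForm (Matrix.of fun i j : Fin 2 => if i.val + j.val + 1 = 2 then (1 : L) else 0) w.1))) : GL (Fin 2) (w.1.adicCompletion L)) : Matrix (Fin 2) (Fin 2) (w.1.adicCompletion L)).trace ^ 2 =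
        Valued.v (4 * (((((localNonsplitEquiv (IsCMField.complexConj L) (Matrix.of fun i j : Fin 2 => if i.val + j.val + 1 = 2 then (1 : L) else 0) (IsCMField.complexConj_ne_one L) w hw) γ₂ : ↥(unitaryGroupOfForm (galAdicCompletionMap (L := L) (IsCMField.complexConj L) hw) (placeForm (Matrix.of fun i j : Fin 2 => if i.val + j.val + 1 = 2 then (1 : L) else 0) w.1))) : GL (Fin 2) (w.1.adicCompletion L)) : Matrix (Fin 2) (Fin 2) (w.1.adicCompletion L)).trace ^ 2 -
          4 * ((((localNonsplitEquiv (IsCMField.complexConj L) (Matrix.of fun i j : Fin 2 => if i.val + j.val + 1 = 2 then (1 : L) else 0) (IsCMField.complexConj_ne_one L) w hw) γ₂ : ↥(unitaryGroupOfForm (galAdicCompletionMap (L := L) (IsCMField.complexConj L) hw) (placeForm (Matrix.of fun i j : Fin 2 => if i.val + j.val + 1 = 2 then (1 : L) else 0) w.1))) : GL (Fin 2) (w.1.adicCompletion L)) : Matrix (Fin 2) (Fin 2) (w.1.adicCompletion L)).det)) := by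
  classical
  set U : Matrix (Fin 2) (Fin 2) (w.1.adicCompletion L) :=
    ((((localNonsplitEquiv (IsCMField.complexConj L) (Matrix.of fun i j : Fin 2 => if i.val + j.val + 1 = 2 then (1 : L) else 0) (IsCMField.complexConj_ne_one L) w hw) γ₂ : ↥(unitaryGroupOfForm (galAdicCompletionMap (L := L) (IsCMField.complexConj L) hw) (placeForm (Matrix.of fun i j : Fin 2 => if i.val + j.val + 1 = 2 then (1 : L) else 0) w.1))) : GL (Fin 2) (w.1.adicCompletion L)) : Matrix (Fin 2) (Fin 2) (w.1.adicCompletion L)) with hU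
  -- instances on `𝒪[L⁺_v]` and `char ≠ 2`
  haveI : IsDiscreteValuationRing 𝒪[v.adicCompletion ↥(maximalRealSubfield L)] := isDiscreteValuationRing_integer_of_compatible hϖF
  haveI : HenselianLocalRing 𝒪[v.adicCompletion ↥(maximalRealSubfield L)] := henselianLocalRing_integer_adicCompletion (↥(maximalRealSubfield L)) v
  haveI : CharZero (w.1.adicCompletion L) := charZero_of_injective_algebraMap (algebraMap L (w.1.adicCompletion L)).injective
  haveI : CharZero (v.adicCompletion ↥(maximalRealSubfield L)) :=
    charZero_of_injective_algebraMap (algebraMap ↥(maximalRealSubfield L) (v.adicCompletion ↥(maximalRealSubfield L))).injective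
  have h2E : (2 : w.1.adicCompletion L) ≠ 0 := two_ne_zero
  have h2F : (2 : v.adicCompletion ↥(maximalRealSubfield L)) ≠ 0 := two_ne_zero
  have hϖ : Valued.v ϖ = exp (-1 : ℤ) := hD.2.2.1
  -- the discriminant of `g` is a non-square; the tube descends
  have hns := not_isSquare_disc_of_descent_of_not_exists_isRoot L v w h2E hα0 hsg hirr
  have hdeep := valuation_disc_lt_of_descent L v w hw he hα0 hsg hϖ hϖF htube
  -- the torus datum of `g`
  obtain ⟨uτ, wτ, z, γ₁, h, c, b, n, dK, hz, hmain, hu, hdat, hdK, hc, hconj, hγ₁, hb, hγ₁det, hbn, hlev⟩ :=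
    exists_torusDatum_of_deep h2F (isUniformizingElement_of_v_eq hϖF) g hns hdeep
  -- the level identity, in `Valued.v` and carried upstairs
  have hlevV : Valued.v ϖF ^ (2 * n + dK) * Valued.v (g : Matrix (Fin 2) (Fin 2) (v.adicCompletion ↥(maximalRealSubfield L))).trace ^ 2 =
      Valued.v (4 * ((g : Matrix (Fin 2) (Fin 2) (v.adicCompletion ↥(maximalRealSubfield L))).trace ^ 2 - 4 * (g : Matrix (Fin 2) (Fin 2) (v.adicCompletion ↥(maximalRealSubfield L))).det)) := by
    have h1 := (v_eq_iff_valuation_eq (ϖF ^ (2 * n + dK) * (g : Matrix (Fin 2) (Fin 2) (v.adicCompletion ↥(maximalRealSubfield L))).trace ^ 2)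
      (4 * ((g : Matrix (Fin 2) (Fin 2) (v.adicCompletion ↥(maximalRealSubfield L))).trace ^ 2 - 4 * (g : Matrix (Fin 2) (Fin 2) (v.adicCompletion ↥(maximalRealSubfield L))).det))).2
      (by rw [map_mul, map_pow, map_pow]; exact hlev)
    rw [map_mul, map_pow, map_pow] at h1
    exact h1
  have hlevU := valued_pow_mul_trace_sq_eq_of_descent L v w hw he hα0 hsg hϖ hϖF hlevV
  have ha : (1 : v.adicCompletion ↥(maximalRealSubfield L)) ∈ 𝒪[v.adicCompletion ↥(maximalRealSubfield L)] := Subring.one_mem _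
  have hγ₁' : (γ₁ : Matrix (Fin 2) (Fin 2) (v.adicCompletion ↥(maximalRealSubfield L))) = !![1, b * wτ; b, 1 + b * uτ] := hγ₁
  refine ⟨uτ, wτ, z, n, dK, hz, hmain, hu, ?_, hdK, hlevU⟩
  rcases hdat with ⟨hwτ, hanis, hdK0⟩ | ⟨hu1, hw1⟩
  · exact Or.inl ⟨hwτ, hanis, hdK0,
      pred_card_valuedResidueField_mul_natCard_fixedBy_add_mod_two_add_two_of_inert L v w hw hα hα0 hϖF he hD hvα γ₂ hs hsg hu hwτ hanis hc hconj hγ₁' ha hb hγ₁det hbn⟩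
  · exact Or.inr ⟨hu1, hw1,
      pred_card_valuedResidueField_mul_natCard_fixedBy_add_mod_two_add_two_of_eisenstein L v w hw hα hα0 hϖF he hD hvα γ₂ hs hsg hu hu1 hw1 hc hconj hγ₁' ha hb hγ₁det hbn⟩

end Place

section Exists

variable (L : Type) [Field L] [NumberField L] [IsCMField L] (v : HeightOneSpectrum (𝓞 ↥(maximalRealSubfield L)))
  (w : PlacesOver L v) (hw : IsCMField.complexConj L • w.1 = w.1)
  {ϖF : v.adicCompletion ↥(maximalRealSubfield L)} (hϖF : Valued.v ϖF = exp (-1 : ℤ))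
  [Finite (IsLocalRing.ResidueField 𝒪[v.adicCompletion ↥(maximalRealSubfield L)])] [Fintype (Valued.ResidueField (w.1.adicCompletion L))]

include hw hϖF in
/-- **(C2) THE H-SIDE CLOSED FORM, SELF-CONTAINED VARIANT** — as `hSide_closedForm_of_tube`, but the anti-fixed `α` (★ `exists_units_galAdicCompletionMap_complexConj_eq_neg_of_ramified`) and
the descent representative `(s, g)` (★ `descent_of_mem_unitaryGroupOfForm_antidiag` ∕ ★ `exists_conj_diagonal_eq_smul_map_toPlace`) are PRODUCED inside and returned with their letters
(`σ_w α = −α`, `|α| = 1 ∨ |α| = exp(−1)`, `s ≠ 0`, `hsg`), so the census file needs only `γ₂`, `hirr` (the :418 letter) and the tube.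
[cite: Kottwitz1988, §2] [cite: LabesseLanglands1979, §2 pp. 7–8] [cite: Rogawski1990, §4.9 Prop. 4.9.1 (b) p. 55, Lemma 4.9.3 p. 56] [cite: Tits1979, §3.2 p. 50] [cite: Serre1979, Ch. I §6; Ch. III §5; Ch. XIV §4] -/
theorem hSide_closedForm_of_tube_exists (he : v.asIdeal.ramificationIdx' w.1.asIdeal ≠ 1)
    {ϖ : w.1.adicCompletion L} {d tE : ℕ} (hD : IsRamifiedQuadraticDatum (galAdicCompletionMap (L := L) (IsCMField.complexConj L) hw) ϖ d tE)
    (γ₂ : ((cmDatum L 2 (Matrix.of fun i j : Fin 2 => if i.val + j.val + 1 = 2 then (1 : L) else 0)).Local v))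
    (hirr : ¬ ∃ x : (w.1.adicCompletion L), ((((localNonsplitEquiv (IsCMField.complexConj L) (Matrix.of fun i j : Fin 2 => if i.val + j.val + 1 = 2 then (1 : L) else 0) (IsCMField.complexConj_ne_one L) w hw) γ₂ : ↥(unitaryGroupOfForm (galAdicCompletionMap (L := L) (IsCMField.complexConj L) hw) (placeForm (Matrix.of fun i j : Fin 2 => if i.val + j.val + 1 = 2 then (1 : L) else 0) w.1))) : GL (Fin 2) (w.1.adicCompletion L)) : Matrix (Fin 2) (Fin 2) (w.1.adicCompletion L)).charpoly.IsRoot x)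
    (htube : Valued.v (((((localNonsplitEquiv (IsCMField.complexConj L) (Matrix.of fun i j : Fin 2 => if i.val + j.val + 1 = 2 then (1 : L) else 0) (IsCMField.complexConj_ne_one L) w hw) γ₂ : ↥(unitaryGroupOfForm (galAdicCompletionMap (L := L) (IsCMField.complexConj L) hw) (placeForm (Matrix.of fun i j : Fin 2 => if i.val + j.val + 1 = 2 then (1 : L) else 0) w.1))) : GL (Fin 2) (w.1.adicCompletion L)) : Matrix (Fin 2) (Fin 2) (w.1.adicCompletion L)).trace ^ 2 - 4 * ((((localNonsplitEquiv (IsCMField.complexConj L) (Matrix.of fun i j : Fin 2 => if i.val + j.val + 1 = 2 then (1 : L) else 0) (IsCMField.complexConj_ne_one L) w hw) γ₂ : ↥(unitaryGroupOfForm (galAdicCompletionMap (L := L) (IsCMField.complexConj L) hw) (placeForm (Matrix.of fun i j : Fin 2 => if i.val + j.val + 1 = 2 then (1 : L) else 0) w.1))) : GL (Fin 2) (w.1.adicCompletion L)) : Matrix (Fin 2) (Fin 2) (w.1.adicCompletion L)).det) < Valued.v (4 : w.1.adicCompletion L) * Valued.v ϖ ^ 2 * Valued.v ((((localNonsplitEquiv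 (IsCMField.complexConj L) (Matrix.of fun i j : Fin 2 => if i.val + j.val + 1 = 2 then (1 : L) else 0) (IsCMField.complexConj_ne_one L) w hw) γ₂ : ↥(unitaryGroupOfForm (galAdicCompletionMap (L := L) (IsCMField.complexConj L) hw) (placeForm (Matrix.of fun i j : Fin 2 => if i.val + j.val + 1 = 2 then (1 : L) else 0) w.1))) : GL (Fin 2) (w.1.adicCompletion L)) : Matrix (Fin 2) (Fin 2) (w.1.adicCompletion L)).trace ^ 2) :
    ∃ (α s : w.1.adicCompletion L) (g : GL (Fin 2) (v.adicCompletion ↥(maximalRealSubfield L))) (uτ wτ z : (v.adicCompletion ↥(maximalRealSubfield L))) (n dK : ℕ),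
      galAdicCompletionMap (L := L) (IsCMField.complexConj L) hw α = -α ∧ (Valued.v α = 1 ∨ Valued.v α = exp (-1 : ℤ)) ∧ s ≠ 0 ∧
      Matrix.diagonal ![1, α] * ((((localNonsplitEquiv (IsCMField.complexConj L) (Matrix.of fun i j : Fin 2 => if i.val + j.val + 1 = 2 then (1 : L) else 0) (IsCMField.complexConj_ne_one L) w hw) γ₂ : ↥(unitaryGroupOfForm (galAdicCompletionMap (L := L) (IsCMField.complexConj L) hw) (placeForm (Matrix.of fun i j : Fin 2 => if i.val + j.val + 1 = 2 then (1 : L) else 0) w.1))) : GL (Fin 2) (w.1.adicCompletion L)) : Matrix (Fin 2) (Fin 2) (w.1.adicCompletion L)) * Matrix.diagonal ![1, α⁻¹] = s • (g : Matrix (Fin 2) (Fin 2) (v.adicCompletion ↥(maximalRealSubfield L))).map (toPlace v w) ∧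
      z ≠ 0 ∧ (uτ ^ 2 + 4 * wτ) * z ^ 2 = (g : Matrix (Fin 2) (Fin 2) (v.adicCompletion ↥(maximalRealSubfield L))).trace ^ 2 - 4 * (g : Matrix (Fin 2) (Fin 2) (v.adicCompletion ↥(maximalRealSubfield L))).det ∧
      uτ ∈ 𝒪[(v.adicCompletion ↥(maximalRealSubfield L))] ∧
      ((wτ ∈ 𝒪[(v.adicCompletion ↥(maximalRealSubfield L))] ∧
          (∀ c e : (v.adicCompletion ↥(maximalRealSubfield L)), c ∈ 𝒪[(v.adicCompletion ↥(maximalRealSubfield L))] → e ∈ 𝒪[(v.adicCompletion ↥(maximalRealSubfield L))] →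
            valuation (v.adicCompletion ↥(maximalRealSubfield L)) (c ^ 2 + c * e * uτ - e ^ 2 * wτ) < 1 → valuation (v.adicCompletion ↥(maximalRealSubfield L)) c < 1 ∧ valuation (v.adicCompletion ↥(maximalRealSubfield L)) e < 1) ∧ dK = 0 ∧
          (Fintype.card (Valued.ResidueField (w.1.adicCompletion L)) - 1) *
              (Nat.card (fixedBy (((cmDatum L 2 (Matrix.of fun i j : Fin 2 => if i.val + j.val + 1 = 2 then (1 : L) else 0)).Local v) ⧸
                cmLocalIntegralLevel L 2 (Matrix.of fun i j : Fin 2 => if i.val + j.val + 1 = 2 then (1 : L) else 0) v) γ₂) + d % 2) + 2 =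
            (Fintype.card (Valued.ResidueField (w.1.adicCompletion L)) + 1) * Fintype.card (Valued.ResidueField (w.1.adicCompletion L)) ^ n) ∨
        (valuation (v.adicCompletion ↥(maximalRealSubfield L)) uτ < 1 ∧ valuation (v.adicCompletion ↥(maximalRealSubfield L)) wτ = valuation (v.adicCompletion ↥(maximalRealSubfield L)) ϖF ∧
          (Fintype.card (Valued.ResidueField (w.1.adicCompletion L)) - 1) *
              (Nat.card (fixedBy (((cmDatum L 2 (Matrix.of fun i j : Fin 2 => if i.val + j.val + 1 = 2 then (1 : L) else 0)).Local v) ⧸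
                cmLocalIntegralLevel L 2 (Matrix.of fun i j : Fin 2 => if i.val + j.val + 1 = 2 then (1 : L) else 0) v) γ₂) + d % 2) + 2 =
            2 * Fintype.card (Valued.ResidueField (w.1.adicCompletion L)) ^ (n + 1))) ∧
      valuation (v.adicCompletion ↥(maximalRealSubfield L)) (uτ ^ 2 + 4 * wτ) = valuation (v.adicCompletion ↥(maximalRealSubfield L)) ϖF ^ dK ∧
      Valued.v ϖ ^ (2 * (2 * n + dK)) * Valued.v ((((localNonsplitEquiv (IsCMField.complexConj L) (Matrix.of fun i j : Fin 2 => if i.val + j.val + 1 = 2 then (1 : L) else 0) (IsCMField.complexConj_ne_one L) w hw) γ₂ : ↥(unitaryGroupOfForm (galAdicCompletionMap (L := L) (IsCMField.complexConj L) hw) (placeForm (Matrix.of fun i j : Fin 2 => if i.val + j.val + 1 = 2 then (1 : L) else 0) w.1))) : GL (Fin 2) (w.1.adicCompletion L)) : Matrix (Fin 2) (Fin 2) (w.1.adicCompletion L)).trace ^ 2 = Valued.v (4 * (((((localNonsplitEquiv (IsCMField.complexConj L) (Matrix.of fun i j : Fin 2 => if i.val + j.val + 1 = 2 then (1 : L)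 else 0) (IsCMField.complexConj_ne_one L) w hw) γ₂ : ↥(unitaryGroupOfForm (galAdicCompletionMap (L := L) (IsCMField.complexConj L) hw) (placeForm (Matrix.of fun i j : Fin 2 => if i.val + j.val + 1 = 2 then (1 : L) else 0) w.1))) : GL (Fin 2) (w.1.adicCompletion L)) : Matrix (Fin 2) (Fin 2) (w.1.adicCompletion L)).trace ^ 2 - 4 * ((((localNonsplitEquiv (IsCMField.complexConj L) (Matrix.of fun i j : Fin 2 => if i.val + j.val + 1 = 2 then (1 : L) else 0) (IsCMField.complexConj_ne_one L) w hw) γ₂ : ↥(unitaryGroupOfForm (galAdicCompletionMap (L := L) (IsCMField.complexConj L) hw) (placeForm (Matrix.of fun i j : Fin 2 => if i.val + j.val + 1 = 2 then (1 : L) else 0) w.1))) : GL (Fin 2) (w.1.adicCompletion L)) : Matrix (Fin 2) (Fin 2) (w.1.adicCompletion L)).det)) := by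
  obtain ⟨α₀, hα₀, hvα₀⟩ := exists_units_galAdicCompletionMap_complexConj_eq_neg_of_ramified L w hw he
  have hα₀0 : (α₀ : w.1.adicCompletion L) ≠ 0 := α₀.ne_zero
  obtain ⟨s, g, hs, hsg⟩ := descent_of_mem_unitaryGroupOfForm_antidiag L v w hw hα₀ hα₀0 _
    (coe_mem_unitaryGroupOfForm_antidiag_two_of_mem_placeForm L w hw
      ((localNonsplitEquiv (IsCMField.complexConj L) (Matrix.of fun i j : Fin 2 => if i.val + j.val + 1 = 2 then (1 : L) else 0) (IsCMField.complexConj_ne_one L) w hw) γ₂))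
  obtain ⟨uτ, wτ, z, n, dK, hz, hmain, hu, hdat, hdK, hlev⟩ :=
    hSide_closedForm_of_tube L v w hw hα₀ hα₀0 hϖF he hD hvα₀ γ₂ hirr hs hsg htube
  exact ⟨α₀, s, g, uτ, wτ, z, n, dK, hα₀, hvα₀, hs, hsg, hz, hmain, hu, hdat, hdK, hlev⟩

end Exists

end Summit.HodgeConjecture.HodgeConjecture.Cruxes.H413.F0P3cDyRamHSideClosedForm

end
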